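import Summits.NavierStokesRegularity.TurbBounds.Certs.P2R3.EvalN16Rule
import Summits.NavierStokesRegularity.TurbBounds.TailP2R3PiecesN161
import Summits.NavierStokesRegularity.TurbBounds.TailP2R3PiecesN162
import Summits.NavierStokesRegularity.TurbBounds.TailP2R3PiecesN163
import Summits.NavierStokesRegularity.TurbBounds.TailP2R3PiecesN164
import Summits.NavierStokesRegularity.TurbBounds.TailP2R3PiecesN165
import Summits.NavierStokesRegularity.TurbBounds.TailP2R3PiecesN166
import Summits.NavierStokesRegularity.TurbBounds.TailP2R3PiecesN167
import Summits.NavierStokesRegularity.TurbBounds.TailPolyGen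
import Summits.NavierStokesRegularity.TurbBounds.P2R3Profile
import HarnessLib

/-!
# Row P2-R3 tail lemma (N16, dim 47) — glue: the tracked finite part `finGen 16 5` IS the quadratic form of the literal rule `N16.MelR`
(cell `pub-turb` / `turb-bounds`; v2; partly GENERATED by HOME/pub-turb-cert/lean-tail-v2/tailgen/emit/emit_tail.py N16 P2R3. Uses the 13 structured piece
identities (`TailP2R3PiecesN161–7`), the ladder dictionary at the stacked vector, `couplingMode_congr`, and `ring` over opaque Parseval sums and
`couplingMode` atoms — the coupling is never expanded here.)

HONEST FRAMING: rigorous bounds for the stated PDE and boundary conditions; no claim about physical turbulence beyond the bound.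
-/

set_option linter.style.longLine false
set_option linter.style.setOption false

noncomputable section

namespace Summit.NavierStokesRegularity.TurbBounds.TailP2R3.N16

open Polynomial Finset Matrix Literature.Computation.Certificates
open Summit.NavierStokesRegularity.TurbBounds.LadderTail (w IsLadder phi lam)
open Summit.NavierStokesRegularity.TurbBounds.CouplingSplit (couplingExact couplingMode couplingMode_congr couplingExact_eq_sum_modes)
open Summit.NavierStokesRegularity.TurbBounds.TailPolyGen (finGen)
open Summit.NavierStokesRegularity.TurbBounds.TailP2R3 (ghatR)
open Summit.NavierStokesRegularity.TurbBounds.Certs.P2R3.Evaluator (s T ghat0 ghat1 ghat2 ghat3 ghat4 ghat5)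
open Summit.NavierStokesRegularity.TurbBounds.Certs.P2R3.Evaluator.N16

/-- quadratic forms are additive in the (rational) matrix -/
theorem qf_add (A B : Matrix (Fin 47) (Fin 47) ℚ) (x : Fin 47 → ℝ) :
    x ⬝ᵥ ((A + B).map (Rat.cast : ℚ → ℝ) *ᵥ x) = x ⬝ᵥ (A.map (Rat.cast : ℚ → ℝ) *ᵥ x) + x ⬝ᵥ (B.map (Rat.cast : ℚ → ℝ) *ᵥ x) := by
  have h : (A + B).map (Rat.cast : ℚ → ℝ) = A.map (Rat.cast : ℚ → ℝ) + B.map (Rat.cast : ℚ → ℝ) := by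
    ext i j; simp [Matrix.map_apply]
  rw [h, add_mulVec, dotProduct_add]

/-- quadratic forms are homogeneous in the (rational) matrix -/
theorem qf_smul (q : ℚ) (A : Matrix (Fin 47) (Fin 47) ℚ) (x : Fin 47 → ℝ) :
    x ⬝ᵥ ((q • A).map (Rat.cast : ℚ → ℝ) *ᵥ x) = (q : ℝ) * (x ⬝ᵥ (A.map (Rat.cast : ℚ → ℝ) *ᵥ x)) := by
  have h : (q • A).map (Rat.cast : ℚ → ℝ) = (q : ℝ) • A.map (Rat.cast : ℚ → ℝ) := by
    ext i j; simp [Matrix.map_apply]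
  rw [h, smul_mulVec, dotProduct_smul, smul_eq_mul]

/-- `xᵀ·MelR(ε;u,v)·x` as the weighted sum of the 13 piece forms. -/
theorem quadForm_MelR_pieces (ε : ℚ) (u v : ℝ) (x : Fin 47 → ℝ) :
    x ⬝ᵥ (MelR ε u v *ᵥ x)
      = ((s : ℚ) - 1 : ℝ) * (x ⬝ᵥ (PW0.map (Rat.cast : ℚ → ℝ) *ᵥ x)) + ((s : ℚ) : ℝ) * (x ⬝ᵥ (PT0.map (Rat.cast : ℚ → ℝ) *ᵥ x))
        + ((ghat0 : ℚ) : ℝ) * (x ⬝ᵥ (CE0.map (Rat.cast : ℚ → ℝ) *ᵥ x)) + ((ghat1 : ℚ) : ℝ) * (x ⬝ᵥ (CE1.map (Rat.cast : ℚ → ℝ) *ᵥ x)) + ((ghat2 : ℚ) : ℝ) * (x ⬝ᵥ (CE2.map (Rat.cast : ℚ → ℝ) *ᵥ x)) + ((ghat3 : ℚ) : ℝ) * (x ⬝ᵥ (CE3.map (Rat.cast : ℚ → ℝ) *ᵥ x)) + ((ghat4 : ℚ) : ℝ) * (x ⬝ᵥ (CE4.map (Rat.cast : ℚ → ℝ)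 *ᵥ x)) + ((ghat5 : ℚ) : ℝ) * (x ⬝ᵥ (CE5.map (Rat.cast : ℚ → ℝ) *ᵥ x))
        + ((-(T * ε) : ℚ) : ℝ) * (x ⬝ᵥ (TW.map (Rat.cast : ℚ → ℝ) *ᵥ x)) + ((-(T / ε) : ℚ) : ℝ) * (x ⬝ᵥ (TT.map (Rat.cast : ℚ → ℝ) *ᵥ x))
        + u * (((s : ℚ) - 1 : ℝ) * (x ⬝ᵥ (PWu.map (Rat.cast : ℚ → ℝ) *ᵥ x)))
        + v * (((s : ℚ) - 1 : ℝ) * (x ⬝ᵥ (PWv.map (Rat.cast : ℚ → ℝ) *ᵥ x)) + ((s : ℚ) : ℝ) * (x ⬝ᵥ (PTv.map (Rat.cast : ℚ → ℝ) *ᵥ x))) := by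
  unfold MelR
  rw [add_mulVec, add_mulVec, dotProduct_add, dotProduct_add, smul_mulVec, smul_mulVec, dotProduct_smul, dotProduct_smul,
    smul_eq_mul, smul_eq_mul]
  simp only [M0, Acoef, Bcoef, qf_add, qf_smul]
  push_cast
  ring

set_option maxRecDepth 100000 in
set_option maxHeartbeats 20000000 in
/-- **Bridge (N16)**: on coefficient sequences linked by the integration ladders, the tracked finite part `finGen 16 5` (with the literal
profile data `ĝ`) at `(u, v, ε)` equals the quadratic form of the literal rule `MelR ε u v` at the stacked vector. -/
theorem finGen_eq_quadForm {c a b d e : ℕ → ℝ} (hA : IsLadder c a) (hB : IsLadder a b) (hE : IsLadder d e)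
    (ha0 : a 0 = c 0 - c 1 / 3) (hb0 : b 0 = a 0 - a 1 / 3) (he0 : e 0 = d 0 - d 1 / 3) (ε : ℚ) (u v : ℝ) :
    finGen 16 5 ((s : ℚ) : ℝ) u v ((ε : ℚ) : ℝ) ((T : ℚ) : ℝ) ghatR c a b d e = (stack c d) ⬝ᵥ (MelR ε u v *ᵥ stack c d) := by
  -- dictionary at the stacked vector
  have hxc := xc_stack c d
  have hxd := xd_stack c d
  have haL := aL_stack (d := d) hA ha0
  have hbL := bL_stack (d := d) hA hB ha0 hb0
  have heL := eL_stack c hE he0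
  -- the coupling modes at the ladder forms are the coupling modes at `b, e`
  have hM0 : couplingMode 16 5 0 (bL (stack c d)) (eL (stack c d)) = couplingMode 16 5 0 b e :=
    couplingMode_congr (fun n hn => hbL n (by omega)) (fun m hm => heL m (by omega))
  have hM1 : couplingMode 16 5 1 (bL (stack c d)) (eL (stack c d)) = couplingMode 16 5 1 b e :=
    couplingMode_congr (fun n hn => hbL n (by omega)) (fun m hm => heL m (by omega))
  have hM2 : couplingMode 16 5 2 (bL (stack c d)) (eL (stack c d)) = couplingMode 16 5 2 b e :=
    couplingMode_congr (fun n hn => hbL n (by omega)) (fun m hm => heL m (by omega))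
  have hM3 : couplingMode 16 5 3 (bL (stack c d)) (eL (stack c d)) = couplingMode 16 5 3 b e :=
    couplingMode_congr (fun n hn => hbL n (by omega)) (fun m hm => heL m (by omega))
  have hM4 : couplingMode 16 5 4 (bL (stack c d)) (eL (stack c d)) = couplingMode 16 5 4 b e :=
    couplingMode_congr (fun n hn => hbL n (by omega)) (fun m hm => heL m (by omega))
  have hM5 : couplingMode 16 5 5 (bL (stack c d)) (eL (stack c d)) = couplingMode 16 5 5 b e :=
    couplingMode_congr (fun n hn => hbL n (by omega)) (fun m hm => heL m (by omega))
  -- Parseval sums at the ladder forms are the Parseval sums at `c, a, b, d, e`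
  have hsc : ∑ n ∈ range 24, w n * xc (stack c d) n ^ 2 = ∑ n ∈ range 24, w n * c n ^ 2 :=
    sum_congr rfl fun n hn => by rw [hxc n (Finset.mem_range.mp hn)]
  have hsa : ∑ n ∈ range 23, w n * aL (stack c d) n ^ 2 = ∑ n ∈ range 23, w n * a n ^ 2 :=
    sum_congr rfl fun n hn => by rw [haL n (Finset.mem_range.mp hn)]
  have hsb : ∑ n ∈ range 22, w n * bL (stack c d) n ^ 2 = ∑ n ∈ range 22, w n * b n ^ 2 :=
    sum_congr rfl fun n hn => by rw [hbL n (Finset.mem_range.mp hn)]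
  have hsd : ∑ n ∈ range 23, w n * xd (stack c d) n ^ 2 = ∑ n ∈ range 23, w n * d n ^ 2 :=
    sum_congr rfl fun n hn => by rw [hxd n (Finset.mem_range.mp hn)]
  have hse : ∑ n ∈ range 22, w n * eL (stack c d) n ^ 2 = ∑ n ∈ range 22, w n * e n ^ 2 :=
    sum_congr rfl fun n hn => by rw [heL n (Finset.mem_range.mp hn)]
  rw [quadForm_MelR_pieces, quadForm_PW0, quadForm_PT0, quadForm_TW, quadForm_TT, quadForm_PWu, quadForm_PWv, quadForm_PTv, quadForm_CE0, quadForm_CE1, quadForm_CE2, quadForm_CE3, quadForm_CE4, quadForm_CE5]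
  rw [hM0, hM1, hM2, hM3, hM4, hM5, hsc, hsa, hsb, hsd, hse]
  rw [hbL 17 (by norm_num), hbL 18 (by norm_num), hbL 19 (by norm_num), hbL 20 (by norm_num), hbL 21 (by norm_num), haL 21 (by norm_num), haL 22 (by norm_num), hxc 22 (by norm_num), hxc 23 (by norm_num),
    heL 17 (by norm_num), heL 18 (by norm_num), heL 19 (by norm_num), heL 20 (by norm_num), heL 21 (by norm_num), hxd 21 (by norm_num), hxd 22 (by norm_num)]
  -- the tracked finite part, coupling mode by mode; small sums expanded, Parseval sums and coupling modes stay opaque atoms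
  unfold finGen
  rw [couplingExact_eq_sum_modes]
  simp only [sum_range_succ, sum_range_zero, zero_add, Nat.reduceAdd, ghatR]
  push_cast
  ring

end Summit.NavierStokesRegularity.TurbBounds.TailP2R3.N16

end
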